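import Summits.QuantumFields.YangMills.Theorems.UnitScaleTiltProp7NestedMeanTowerClosenessT3
import Literature.MathematicalPhysics.QuantumFieldTheory.Balaban1983to89.B5Eq117TorusCarriers
import HarnessLib

/-!
# Route `UnitScaleTilt`, crux K1 «MinimiserStabilityRegPr» (stmt-QuantumFields-19200), EX positivity block, the LOD ∕ Combes–Thomas line for the curved γ-row ∕ `h349`
# (★p1 g24 `LOCATE-P349-CT`, ★★OWNER RULINGS №33 ∕ №34) — **PEN (BUMP), FILE 1∕3: THE GENERIC LETTERS OF THE COVARIANT BLOCK BUMPS** — (§1) the one-bond transport algebra of a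
# frame-dressed profile `W·(a′·C′⁻¹cC′)·W⁻¹ − a·C⁻¹cC` (cost `2|a′|s + |a′ − a|` when the gauge-transformed link `A W A′⁻¹` is `s`-close to `1`), (§2) the POINTWISE NEUMANN LEMMA
# (a linear `𝔐` on `ι → V` with `‖(𝔐c)(y) − c(y)‖ ≤ κ‖c(y)‖`, `κ < 1`, is invertible with `‖(𝔐⁻¹c)(y)‖ ≤ ‖c(y)‖∕(1 − κ)`), (§3) the PARABOLA BLOCK PROFILE
# `Π_ν m_ν(ℓ − 1 − m_ν)`, `m_ν = x_ν mod ℓ`, `ℓ = L^k`, on Bałaban's torus: non-negative, `≤ (ℓ²∕4)^d`, block mass `(ℓ(ℓ−1)(ℓ−2)∕6)^d` on EVERY `k`-block, and across one fine bond EITHER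
# both ends in one block with an `ℓ(ℓ²∕4)^{d−1}`-Lipschitz step OR zero at both ends

Cell `ym3-torus` (HUMAN RULING D-0037: YM₃ on T³ is ladder rung R3 — NOT d = 4, NOT infinite volume, NOT a mass gap, NOT Clay).  Width seat `ym3-torus-px10` (gen 9; WIDTH COPY «width 10»);
chair ★p1 g24 2026-08-29T21:49:33Z «px10 g9 ← (BUMP)»; one-page LOCATE `HOME/ym3-torus-px10/g9/LOCATE-BUMP-px10g9.md` (19200 evidence #51).  THEOREMS ONLY (0 `def`, 0 `sorry`),
generic (`Params`, any normed ring); `--supports stmt-QuantumFields-19200 --as helper`, count-neutral.  HONEST LABEL (№33 (6)): letters of the curved γ-row supplier line (LOD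
localisation); the line has ONE [Balaban1985BackgroundPropagators] Thm 3.1-class Agmon brick (L3′) inside (Track A road cited); NOTHING of (3.49), Thm 3.3, `h349`, `hGF`, EX or
the crux is proved here or in files 2∕3.

THE MATHEMATICS.  (§1) For units `A, A′, E, W` of norm ≤ 1 with inverses of norm ≤ 1 (`U1`), references `C = E⁻¹A`, `C′ = E⁻¹A′`, and `h := A W A′⁻¹` with `‖h − 1‖ ≤ s`:
`W C′⁻¹ = C⁻¹·(E⁻¹hE)` (a group identity), so `W(a′C′⁻¹cC′)W⁻¹ − aC⁻¹cC = C⁻¹[a′·h̃ch̃⁻¹ − a·c]C`, `h̃ = E⁻¹hE`, and `‖h̃ch̃⁻¹ − c‖ ≤ 2s‖c‖` — the covariant difference of a dressed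
profile costs the profile step plus the axial-gauge deviation of the link ([Balaban1985RegularSpaces] Lemma 1 supplies `s = 2d(L^k − 1)·a₀` in the corner-axial gauge of a block,
✓`Prop7NestedMeanTowerCloseness.dist1_axial_corner_le`).  (§2) `d := 𝔐⁻¹c` solves `d(y) = c(y) − ((𝔐d)(y) − d(y))`, whence `‖d(y)‖ ≤ ‖c(y)‖ + κ‖d(y)‖` pointwise; injectivity gives
bijectivity in finite dimension — no operator norm, no geometric series.  (§3) `Σ_{m<ℓ} m(ℓ−1−m) = ℓ(ℓ−1)(ℓ−2)∕6 ≥ ℓ³∕27` (`ℓ ≥ 3`); the offsets of `B^k(y)` run over `{0,…,ℓ−1}^d`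
(✓`B5Eq117TorusCarriers.sum_iterBlock_eq`∕`val_blockSiteK`), so the block mass is `Π_νΣ_i = (Σ_iτ(i))^d` on every block; a fine bond `⟨x, ν⟩` with `x_ν mod ℓ < ℓ − 1` stays in
the block of `x` and raises the `ν`-offset by one (no torus seam inside a block: `x_ν + 1 < |T|`), otherwise `x_ν mod ℓ = ℓ − 1` and `(x + e_ν)_ν mod ℓ = 0` — the parabola
vanishes at both.

References: T. Bałaban, CMP **99** (1985) 75–102 [Balaban1985RegularSpaces] (Lemma 1 (1.25) p.79); CMP **98** (1985) 17–51 [Balaban1985Averaging] ((19)–(20) p.21, (97) p.32);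
CMP **95** (1984) 17–40 [Balaban1984PropagatorsI] ((1.6) p.18, (1.18) p.20); CMP **99** (1985) 389–434 [Balaban1985BackgroundPropagators] ((3.3) p.391).
-/

set_option autoImplicit false

noncomputable section

open scoped BigOperators Matrix.Norms.L2Operator

namespace Summit.QuantumFields.YangMills.Theorems.Prop7CovariantBlockBumpsProfile

open Literature.MathematicalPhysics.QuantumFieldTheory.Balaban1983to89
open Finset T4Continuum BlockAveraging
open B5Eq118OneStroke (iterBlockOf iterBlock mem_iterBlock val_iterBlockOf card_iterBlock)
open B5Eq117TorusCarriers (blockSiteK val_blockSiteK sum_iterBlock_eq)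
open B7Prop1Explicit (U1 mem_U1 norm_inv_sub_one_le)
open B7Eq78Linearization (conjR conjR_apply conjR_sub conjR_smul)
open B8Ineq132 (norm_conjR norm_conjR_le conjR_conjR)

/-! ## §1 The transport algebra of a dressed bump across one bond (generic normed ring) -/

section Transport

variable {𝔸 : Type*} [NormedRing 𝔸] [NormOneClass 𝔸]

/-- conjugation by a `U1` unit moves a unit `h` with `‖h − 1‖ ≤ s` to a unit with the same bound: `‖E⁻¹hE − 1‖ ≤ s`. [cite: Balaban1985Averaging, (19)-(20) p.21] -/
theorem norm_conj_unit_sub_one_le {E h : 𝔸ˣ} (hE : E ∈ U1 𝔸) {s : ℝ} (hh : ‖(h : 𝔸) - 1‖ ≤ s) :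
    ‖((E⁻¹ * h * E : 𝔸ˣ) : 𝔸) - 1‖ ≤ s := by
  have e : ((E⁻¹ * h * E : 𝔸ˣ) : 𝔸) - 1 = conjR E⁻¹ ((h : 𝔸) - 1) := by
    rw [conjR_apply, inv_inv, Units.val_mul, Units.val_mul, mul_sub, sub_mul, mul_one, Units.inv_mul]
  rw [e]
  exact (norm_conjR_le ((U1 𝔸).inv_mem hE) _).trans hh

/-- for a `U1` unit `g` with `‖g − 1‖ ≤ s`: `‖g c g⁻¹ − c‖ ≤ 2s‖c‖`. [cite: Balaban1985Averaging, (19)-(20) p.21] -/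
theorem norm_conjR_sub_self_le {g : 𝔸ˣ} (hg : g ∈ U1 𝔸) {s : ℝ} (hs : ‖(g : 𝔸) - 1‖ ≤ s) (c : 𝔸) :
    ‖conjR g c - c‖ ≤ 2 * s * ‖c‖ := by
  have hgi1 : ‖((g⁻¹ : 𝔸ˣ) : 𝔸)‖ ≤ 1 := (mem_U1.1 hg).2
  have hgi : ‖((g⁻¹ : 𝔸ˣ) : 𝔸) - 1‖ ≤ s := (norm_inv_sub_one_le hg).trans hs
  have e : conjR g c - c = ((g : 𝔸) - 1) * c * ((g⁻¹ : 𝔸ˣ) : 𝔸) + c * (((g⁻¹ : 𝔸ˣ) : 𝔸) - 1) := by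
    rw [conjR_apply]; noncomm_ring
  rw [e]
  have h0 : 0 ≤ s := (norm_nonneg _).trans hs
  calc ‖((g : 𝔸) - 1) * c * ((g⁻¹ : 𝔸ˣ) : 𝔸) + c * (((g⁻¹ : 𝔸ˣ) : 𝔸) - 1)‖
      ≤ ‖(g : 𝔸) - 1‖ * ‖c‖ * ‖((g⁻¹ : 𝔸ˣ) : 𝔸)‖ + ‖c‖ * ‖((g⁻¹ : 𝔸ˣ) : 𝔸) - 1‖ :=
        (norm_add_le _ _).trans (add_le_add ((norm_mul_le _ _).trans (mul_le_mul_of_nonneg_right (norm_mul_le _ _) (norm_nonneg _))) (norm_mul_le _ _))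
    _ ≤ s * ‖c‖ * 1 + ‖c‖ * s := by gcongr
    _ = 2 * s * ‖c‖ := by ring

/-- ★ **THE ONE-BOND TRANSPORT OF A DRESSED BUMP.**  Frames `A, A′` (axial holonomies to the two endpoints), base `E`, bond variable `W`, all `U1` units; references
`C = E⁻¹A`, `C′ = E⁻¹A′`; gauge-transformed link `h = A W A′⁻¹` with `‖h − 1‖ ≤ s`.  Then for scalars `a, a′` and any `c`,
`‖W·(a′ • C′⁻¹ c C′)·W⁻¹ − a • C⁻¹ c C‖ ≤ (2|a′|s + |a′ − a|)·‖c‖` — the covariant difference of the dressed profile costs the profile's difference plus the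
axial-gauge deviation of the link. [cite: Balaban1985RegularSpaces, Lemma 1 (1.25) p.79; Balaban1985BackgroundPropagators, (3.3) p.391] -/
theorem norm_transport_dressed_sub_le [NormedAlgebra ℂ 𝔸] {A A' E W : 𝔸ˣ} (hE : E ∈ U1 𝔸) (hA : A ∈ U1 𝔸) (hA' : A' ∈ U1 𝔸) (hW : W ∈ U1 𝔸)
    {s : ℝ} (hs : ‖((A * W * A'⁻¹ : 𝔸ˣ) : 𝔸) - 1‖ ≤ s) (a a' : ℝ) (c : 𝔸) :
    ‖conjR W ((a' : ℂ) • conjR (E⁻¹ * A')⁻¹ c) - (a : ℂ) • conjR (E⁻¹ * A)⁻¹ c‖ ≤ (2 * |a'| * s + |a' - a|) * ‖c‖ := by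
  -- `W · C′⁻¹ = C⁻¹ · h̃`, `h̃ = E⁻¹ h E`
  set ht : 𝔸ˣ := E⁻¹ * (A * W * A'⁻¹) * E with hht
  have hkey : W * (E⁻¹ * A')⁻¹ = (E⁻¹ * A)⁻¹ * ht := by
    rw [hht]; group
  have hmem : ht ∈ U1 𝔸 := by
    rw [hht]
    exact (U1 𝔸).mul_mem ((U1 𝔸).mul_mem ((U1 𝔸).inv_mem hE) ((U1 𝔸).mul_mem ((U1 𝔸).mul_mem hA hW) ((U1 𝔸).inv_mem hA'))) hE
  have hts : ‖(ht : 𝔸) - 1‖ ≤ s := by rw [hht]; exact norm_conj_unit_sub_one_le hE hs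
  have e1 : conjR W ((a' : ℂ) • conjR (E⁻¹ * A')⁻¹ c) = conjR (E⁻¹ * A)⁻¹ ((a' : ℂ) • conjR ht c) := by
    rw [conjR_smul, conjR_smul, conjR_conjR, hkey, ← conjR_conjR]
  have e2 : conjR W ((a' : ℂ) • conjR (E⁻¹ * A')⁻¹ c) - (a : ℂ) • conjR (E⁻¹ * A)⁻¹ c
      = conjR (E⁻¹ * A)⁻¹ ((a' : ℂ) • conjR ht c - (a : ℂ) • c) := by
    rw [e1, conjR_sub, conjR_smul (E⁻¹ * A)⁻¹ (a : ℂ) c]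
  rw [e2]
  have hCmem : (E⁻¹ * A)⁻¹ ∈ U1 𝔸 := (U1 𝔸).inv_mem ((U1 𝔸).mul_mem ((U1 𝔸).inv_mem hE) hA)
  refine (norm_conjR_le hCmem _).trans ?_
  have e3 : (a' : ℂ) • conjR ht c - (a : ℂ) • c = (a' : ℂ) • (conjR ht c - c) + ((a' : ℂ) - (a : ℂ)) • c := by
    rw [smul_sub, sub_smul]; abel
  rw [e3]
  have h1 : ‖(a' : ℂ) • (conjR ht c - c)‖ ≤ |a'| * (2 * s * ‖c‖) := by
    rw [norm_smul, Complex.norm_real, Real.norm_eq_abs]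
    exact mul_le_mul_of_nonneg_left (norm_conjR_sub_self_le hmem hts c) (abs_nonneg _)
  have h2 : ‖((a' : ℂ) - (a : ℂ)) • c‖ = |a' - a| * ‖c‖ := by
    rw [norm_smul, ← Complex.ofReal_sub, Complex.norm_real, Real.norm_eq_abs]
  calc ‖(a' : ℂ) • (conjR ht c - c) + ((a' : ℂ) - (a : ℂ)) • c‖ ≤ |a'| * (2 * s * ‖c‖) + |a' - a| * ‖c‖ :=
        (norm_add_le _ _).trans (add_le_add h1 h2.le)
    _ = (2 * |a'| * s + |a' - a|) * ‖c‖ := by ring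

end Transport

/-! ## §2 A pointwise-dominated perturbation of the identity is invertible with a pointwise bound (the Neumann step) -/

section Neumann

variable {𝕜 : Type*} [RCLike 𝕜] {ι : Type*} [Fintype ι] {V : Type*} [NormedAddCommGroup V] [NormedSpace 𝕜 V] [FiniteDimensional 𝕜 V]

/-- ★ **POINTWISE NEUMANN LEMMA**: a linear `𝔐` on `ι → V` with `‖(𝔐c)(y) − c(y)‖ ≤ κ‖c(y)‖` for every `y` (`κ < 1`) is bijective, and the solution of `𝔐 d = c` obeys
`‖d(y)‖ ≤ ‖c(y)‖ ∕ (1 − κ)` at EVERY `y` — no operator norm, no series: `d(y) = c(y) − ((𝔐d)(y) − d(y))`. [folklore] -/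
theorem exists_rightInverse_of_pointwise {𝔐 : (ι → V) →ₗ[𝕜] (ι → V)} {κ : ℝ} (hκ : κ < 1)
    (h𝔐 : ∀ (c : ι → V) (y : ι), ‖𝔐 c y - c y‖ ≤ κ * ‖c y‖) :
    ∃ 𝔑 : (ι → V) →ₗ[𝕜] (ι → V), (∀ c, 𝔐 (𝔑 c) = c) ∧ (∀ c, 𝔑 (𝔐 c) = c) ∧ ∀ (c : ι → V) (y : ι), ‖𝔑 c y‖ ≤ ‖c y‖ / (1 - κ) := by
  -- the a-priori pointwise bound for solutions
  have hapr : ∀ d : ι → V, ∀ y, ‖d y‖ ≤ ‖𝔐 d y‖ / (1 - κ) := by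
    intro d y
    rw [le_div_iff₀ (by linarith)]
    have h1 : ‖d y‖ ≤ ‖𝔐 d y‖ + ‖𝔐 d y - d y‖ := by
      have := norm_sub_le (𝔐 d y) (𝔐 d y - d y); rwa [sub_sub_cancel] at this
    have h2 := h𝔐 d y
    nlinarith
  -- injective, hence bijective
  have hinj : Function.Injective 𝔐 := by
    rw [← LinearMap.ker_eq_bot, LinearMap.ker_eq_bot']
    intro d hd
    funext y
    have h := hapr d y
    rw [hd, Pi.zero_apply, norm_zero, zero_div] at h
    exact norm_le_zero_iff.1 h
  have hbij : Function.Bijective 𝔐 := ⟨hinj, LinearMap.injective_iff_surjective.1 hinj⟩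
  let e : (ι → V) ≃ₗ[𝕜] (ι → V) := LinearEquiv.ofBijective 𝔐 hbij
  refine ⟨e.symm.toLinearMap, fun c => ?_, fun c => ?_, fun c y => ?_⟩
  · exact e.apply_symm_apply c
  · exact e.symm_apply_apply c
  · have h := hapr (e.symm c) y
    have he : 𝔐 (e.symm c) = c := e.apply_symm_apply c
    rw [he] at h
    exact h

end Neumann

/-! ## §3 The parabola block profile `w(x) = Π_ν m_ν(x)·(ℓ − 1 − m_ν(x))`, `m_ν(x) = x_ν mod ℓ`, `ℓ = L^k` -/

section Profile

variable {P : Params} {k : ℕ}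

/-- the one-dimensional parabola `τ(m) = m(ℓ − 1 − m)` is non-negative on `0 ≤ m ≤ ℓ − 1`. [folklore] -/
theorem tau_nonneg {ℓ m : ℕ} (hm : m < ℓ) : 0 ≤ (m : ℝ) * ((ℓ : ℝ) - 1 - m) := by
  have h : (m : ℝ) + 1 ≤ ℓ := by exact_mod_cast hm
  exact mul_nonneg (Nat.cast_nonneg m) (by linarith)

/-- `τ(m) ≤ ℓ²∕4`. [folklore] -/
theorem tau_le {ℓ : ℕ} (m : ℕ) : (m : ℝ) * ((ℓ : ℝ) - 1 - m) ≤ (ℓ : ℝ) ^ 2 / 4 := by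
  nlinarith [sq_nonneg (2 * (m : ℝ) - ((ℓ : ℝ) - 1)), sq_nonneg ((ℓ : ℝ) - 1), Nat.cast_nonneg (α := ℝ) ℓ]

/-- `τ` vanishes on both boundary layers: `τ(0) = 0`, `τ(ℓ − 1) = 0`. [folklore] -/
theorem tau_zero (ℓ : ℕ) : ((0 : ℕ) : ℝ) * ((ℓ : ℝ) - 1 - (0 : ℕ)) = 0 := by simp

/-- `τ(ℓ − 1) = 0` (`1 ≤ ℓ`). [folklore] -/
theorem tau_last {ℓ : ℕ} (hℓ : 1 ≤ ℓ) : (((ℓ - 1 : ℕ)) : ℝ) * ((ℓ : ℝ) - 1 - ((ℓ - 1 : ℕ) : ℝ)) = 0 := by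
  rw [Nat.cast_sub hℓ, Nat.cast_one, sub_self, mul_zero]

/-- the parabola is `ℓ`-Lipschitz between consecutive layers: `|τ(m+1) − τ(m)| ≤ ℓ` for `m + 1 < ℓ`. [folklore] -/
theorem abs_tau_succ_sub_le {ℓ m : ℕ} (hm : m + 1 < ℓ) :
    |(((m + 1 : ℕ)) : ℝ) * ((ℓ : ℝ) - 1 - ((m + 1 : ℕ) : ℝ)) - (m : ℝ) * ((ℓ : ℝ) - 1 - m)| ≤ ℓ := by
  have h : (m : ℝ) + 2 ≤ ℓ := by exact_mod_cast hm
  push_cast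
  rw [abs_le]
  constructor <;> nlinarith [Nat.cast_nonneg (α := ℝ) m]

/-- `Σ_{m<ℓ} m = ℓ(ℓ−1)∕2`. [folklore] -/
theorem sum_range_cast_eq (ℓ : ℕ) : ∑ m ∈ range ℓ, (m : ℝ) = (ℓ : ℝ) * ((ℓ : ℝ) - 1) / 2 := by
  induction ℓ with
  | zero => simp
  | succ n ih => rw [sum_range_succ, ih]; push_cast; ring

/-- `Σ_{m<ℓ} m² = ℓ(ℓ−1)(2ℓ−1)∕6`. [folklore] -/
theorem sum_range_cast_sq_eq (ℓ : ℕ) : ∑ m ∈ range ℓ, (m : ℝ) ^ 2 = (ℓ : ℝ) * ((ℓ : ℝ) - 1) * (2 * (ℓ : ℝ) - 1) / 6 := by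
  induction ℓ with
  | zero => simp
  | succ n ih => rw [sum_range_succ, ih]; push_cast; ring

/-- **THE MASS OF THE PARABOLA**: `Σ_{m<ℓ} m(ℓ − 1 − m) = ℓ(ℓ − 1)(ℓ − 2)∕6`. [folklore] -/
theorem sum_tau_eq (ℓ : ℕ) : ∑ m ∈ range ℓ, (m : ℝ) * ((ℓ : ℝ) - 1 - m) = (ℓ : ℝ) * ((ℓ : ℝ) - 1) * ((ℓ : ℝ) - 2) / 6 := by
  have h : ∀ m : ℕ, (m : ℝ) * ((ℓ : ℝ) - 1 - m) = ((ℓ : ℝ) - 1) * (m : ℝ) - (m : ℝ) ^ 2 := fun m => by ring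
  simp_rw [h, sum_sub_distrib, ← mul_sum, sum_range_cast_eq, sum_range_cast_sq_eq]
  ring

/-- over `Fin ℓ`: the same mass. [folklore] -/
theorem sum_fin_tau_eq (ℓ : ℕ) : ∑ i : Fin ℓ, ((i : ℕ) : ℝ) * ((ℓ : ℝ) - 1 - ((i : ℕ) : ℝ)) = (ℓ : ℝ) * ((ℓ : ℝ) - 1) * ((ℓ : ℝ) - 2) / 6 := by
  rw [Fin.sum_univ_eq_sum_range (fun m => (m : ℝ) * ((ℓ : ℝ) - 1 - m)) ℓ, sum_tau_eq]

/-- the mass is at least `ℓ³∕27` once `ℓ ≥ 3`. [folklore] -/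
theorem mass_ge {ℓ : ℕ} (hℓ : 3 ≤ ℓ) : (ℓ : ℝ) ^ 3 / 27 ≤ (ℓ : ℝ) * ((ℓ : ℝ) - 1) * ((ℓ : ℝ) - 2) / 6 := by
  have h : (3 : ℝ) ≤ ℓ := by exact_mod_cast hℓ
  nlinarith [mul_nonneg (mul_nonneg (by linarith : (0:ℝ) ≤ ℓ) (by linarith : (0:ℝ) ≤ ℓ - 3)) (by linarith : (0:ℝ) ≤ ℓ),
    mul_nonneg (by linarith : (0:ℝ) ≤ ℓ) (by linarith : (0:ℝ) ≤ ℓ - 3)]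

/-- **THE BLOCK PROFILE IS NON-NEGATIVE**: `0 ≤ Π_ν m_ν(ℓ−1−m_ν)`, `m_ν = x_ν mod ℓ < ℓ`. [folklore] -/
theorem profile_nonneg (hℓ : 0 < P.L ^ k) (x : Site P 0) :
    0 ≤ ∏ ν : Fin P.d, (((x ν).val % P.L ^ k : ℕ) : ℝ) * (((P.L ^ k : ℕ) : ℝ) - 1 - (((x ν).val % P.L ^ k : ℕ) : ℝ)) :=
  prod_nonneg fun _ _ => tau_nonneg (Nat.mod_lt _ hℓ)

/-- **THE BLOCK PROFILE IS BOUNDED**: `Π_ν τ(m_ν) ≤ (ℓ²∕4)^d`. [folklore] -/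
theorem profile_le (hℓ : 0 < P.L ^ k) (x : Site P 0) :
    ∏ ν : Fin P.d, (((x ν).val % P.L ^ k : ℕ) : ℝ) * (((P.L ^ k : ℕ) : ℝ) - 1 - (((x ν).val % P.L ^ k : ℕ) : ℝ)) ≤ ((((P.L ^ k : ℕ) : ℝ)) ^ 2 / 4) ^ P.d := by
  calc ∏ ν : Fin P.d, (((x ν).val % P.L ^ k : ℕ) : ℝ) * (((P.L ^ k : ℕ) : ℝ) - 1 - (((x ν).val % P.L ^ k : ℕ) : ℝ))
      ≤ ∏ _ν : Fin P.d, (((P.L ^ k : ℕ) : ℝ)) ^ 2 / 4 := prod_le_prod (fun _ _ => tau_nonneg (Nat.mod_lt _ hℓ)) fun _ _ => tau_le _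
    _ = ((((P.L ^ k : ℕ) : ℝ)) ^ 2 / 4) ^ P.d := by rw [prod_const, card_univ, Fintype.card_fin]

/-- **THE MASS OF THE BLOCK PROFILE IS THE SAME ON EVERY BLOCK**: `Σ_{x ∈ B^k(y)} Π_ν τ(x_ν mod ℓ) = (ℓ(ℓ−1)(ℓ−2)∕6)^d` (the offsets of `B^k(y)` run over
`{0,…,ℓ−1}^d`, ✓`sum_iterBlock_eq`∕`val_blockSiteK`, then `Π_ν Σ_i = Σ_j Π_ν`). [cite: Balaban1984PropagatorsI, (1.18) p.20] -/
theorem sum_iterBlock_profile_eq (hk : k ≤ P.m + P.K) (y : Site P k) :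
    ∑ x ∈ iterBlock k y, ∏ ν : Fin P.d, (((x ν).val % P.L ^ k : ℕ) : ℝ) * (((P.L ^ k : ℕ) : ℝ) - 1 - (((x ν).val % P.L ^ k : ℕ) : ℝ))
      = ((((P.L ^ k : ℕ) : ℝ)) * (((P.L ^ k : ℕ) : ℝ) - 1) * (((P.L ^ k : ℕ) : ℝ) - 2) / 6) ^ P.d := by
  classical
  rw [sum_iterBlock_eq hk]
  have hoff : ∀ (j : Fin P.d → Fin (P.L ^ k)) (ν : Fin P.d), (blockSiteK k y j ν).val % P.L ^ k = (j ν : ℕ) := by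
    intro j ν
    rw [val_blockSiteK hk, Nat.mul_add_mod', Nat.mod_eq_of_lt (j ν).isLt]
  simp_rw [hoff]
  rw [← Fintype.prod_sum (fun (ν : Fin P.d) (i : Fin (P.L ^ k)) => ((i : ℕ) : ℝ) * (((P.L ^ k : ℕ) : ℝ) - 1 - ((i : ℕ) : ℝ)))]
  simp_rw [sum_fin_tau_eq]
  rw [prod_const, card_univ, Fintype.card_fin]

/-- **NEIGHBOURS INSIDE A BLOCK**: if `x_ν mod ℓ < ℓ − 1` then `x + e_ν` lies in the same `k`-block as `x`, its `ν`-offset is `x_ν mod ℓ + 1`, and its other offsets are those of `x`.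
[cite: Balaban1984PropagatorsI, (1.6) p.18] -/
theorem shift_offsets_of_lt (hk : k ≤ P.m + P.K) (x : Site P 0) (ν : Fin P.d) (hν : (x ν).val % P.L ^ k + 1 < P.L ^ k) :
    iterBlockOf k (x.shift ν) = iterBlockOf k x ∧ ((x.shift ν) ν).val % P.L ^ k = (x ν).val % P.L ^ k + 1 ∧
      ∀ μ, μ ≠ ν → ((x.shift ν) μ).val = (x μ).val := by
  have hℓ : 0 < P.L ^ k := pow_pos P.L_pos k
  have hN : P.sitesPerDir 0 = P.sitesPerDir k * P.L ^ k := Prop7FlatHolonomy.sitesPerDir_zero_eq_mul_pow hk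
  haveI : Fact (1 < P.sitesPerDir 0) := ⟨P.one_lt_sitesPerDir 0⟩
  set v := (x ν).val with hv
  -- `v + 1 < N`: the block of `x` is not cut by the torus seam
  have hq : v / P.L ^ k < P.sitesPerDir k := by
    rw [Nat.div_lt_iff_lt_mul hℓ, ← hN]; exact ZMod.val_lt (x ν)
  have hdm := Nat.div_add_mod v (P.L ^ k)
  have hv1 : v + 1 < P.sitesPerDir 0 := by
    rw [hN]
    have : (v / P.L ^ k + 1) * P.L ^ k ≤ P.sitesPerDir k * P.L ^ k := Nat.mul_le_mul_right _ hq
    rw [Nat.add_mul, one_mul] at this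
    have h2 : v < P.L ^ k * (v / P.L ^ k) + (P.L ^ k - 1) := by omega
    nlinarith [Nat.mul_comm (P.L ^ k) (v / P.L ^ k)]
  have hval : ((x.shift ν) ν).val = v + 1 := by
    rw [Site.shift_apply, if_pos rfl, ZMod.val_add, ZMod.val_one, Nat.mod_eq_of_lt hv1]
  have hothers : ∀ μ, μ ≠ ν → ((x.shift ν) μ).val = (x μ).val := fun μ hμ => by rw [Site.shift_apply, if_neg hμ]
  -- the offset and the block index of `v + 1`
  have hmod : (v + 1) % P.L ^ k = v % P.L ^ k + 1 := by
    have h1 : v + 1 = P.L ^ k * (v / P.L ^ k) + (v % P.L ^ k + 1) := by omega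
    rw [h1, Nat.mul_add_mod_self_left, Nat.mod_eq_of_lt hν]
  have hdiv : (v + 1) / P.L ^ k = v / P.L ^ k := by
    have h1 : v + 1 = P.L ^ k * (v / P.L ^ k) + (v % P.L ^ k + 1) := by omega
    rw [h1, Nat.mul_add_div hℓ, Nat.div_eq_of_lt hν, add_zero]
  refine ⟨?_, by rw [hval, hmod], hothers⟩
  funext μ
  apply ZMod.val_injective
  rw [val_iterBlockOf k hk, val_iterBlockOf k hk]
  by_cases hμ : μ = ν
  · subst hμ; rw [hval, hdiv]
  · rw [hothers μ hμ]

/-- **CROSSING A BLOCK FACE**: if `x_ν mod ℓ = ℓ − 1` then the `ν`-offset of `x + e_ν` is `0` (the profile vanishes at both ends of the bond). [cite: Balaban1984PropagatorsI, (1.6) p.18] -/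
theorem shift_offset_eq_zero_of_eq (hk : k ≤ P.m + P.K) (x : Site P 0) (ν : Fin P.d) (hν : (x ν).val % P.L ^ k + 1 = P.L ^ k) :
    ((x.shift ν) ν).val % P.L ^ k = 0 := by
  have hℓ : 0 < P.L ^ k := pow_pos P.L_pos k
  have hN : P.sitesPerDir 0 = P.sitesPerDir k * P.L ^ k := Prop7FlatHolonomy.sitesPerDir_zero_eq_mul_pow hk
  haveI : NeZero (P.sitesPerDir 0) := ⟨by have := P.one_lt_sitesPerDir 0; omega⟩
  haveI : Fact (1 < P.sitesPerDir 0) := ⟨P.one_lt_sitesPerDir 0⟩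
  set v := (x ν).val with hv
  have hdvd : P.L ^ k ∣ P.sitesPerDir 0 := ⟨P.sitesPerDir k, by rw [hN, mul_comm]⟩
  rw [Site.shift_apply, if_pos rfl, ZMod.val_add, ZMod.val_one, Nat.mod_mod_of_dvd _ hdvd]
  have h1 : v + 1 = P.L ^ k * (v / P.L ^ k) + (v % P.L ^ k + 1) := by have := Nat.div_add_mod v (P.L ^ k); omega
  rw [h1, Nat.mul_add_mod_self_left, hν, Nat.mod_self]

/-- **THE PROFILE ACROSS ONE BOND**: for every fine bond `⟨x, ν⟩`, EITHER both endpoints lie in one `k`-block and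
`|w(x + e_ν) − w(x)| ≤ ℓ·(ℓ²∕4)^{d−1}`, OR the profile vanishes at both endpoints. [cite: Balaban1984PropagatorsI, (1.6) p.18] -/
theorem profile_bond (hk : k ≤ P.m + P.K) (x : Site P 0) (ν : Fin P.d) :
    (iterBlockOf k (x.shift ν) = iterBlockOf k x ∧
      |(∏ μ : Fin P.d, ((((x.shift ν) μ).val % P.L ^ k : ℕ) : ℝ) * (((P.L ^ k : ℕ) : ℝ) - 1 - ((((x.shift ν) μ).val % P.L ^ k : ℕ) : ℝ)))
        - ∏ μ : Fin P.d, (((x μ).val % P.L ^ k : ℕ) : ℝ) * (((P.L ^ k : ℕ) : ℝ) - 1 - (((x μ).val % P.L ^ k : ℕ) : ℝ))|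
        ≤ ((P.L ^ k : ℕ) : ℝ) * (((((P.L ^ k : ℕ) : ℝ)) ^ 2 / 4) ^ (P.d - 1))) ∨
    ((∏ μ : Fin P.d, ((((x.shift ν) μ).val % P.L ^ k : ℕ) : ℝ) * (((P.L ^ k : ℕ) : ℝ) - 1 - ((((x.shift ν) μ).val % P.L ^ k : ℕ) : ℝ))) = 0 ∧
      (∏ μ : Fin P.d, (((x μ).val % P.L ^ k : ℕ) : ℝ) * (((P.L ^ k : ℕ) : ℝ) - 1 - (((x μ).val % P.L ^ k : ℕ) : ℝ))) = 0) := by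
  have hℓ : 0 < P.L ^ k := pow_pos P.L_pos k
  have hlt : (x ν).val % P.L ^ k < P.L ^ k := Nat.mod_lt _ hℓ
  by_cases hcase : (x ν).val % P.L ^ k + 1 < P.L ^ k
  · left
    obtain ⟨hblk, hoff, hothers⟩ := shift_offsets_of_lt hk x ν hcase
    refine ⟨hblk, ?_⟩
    -- split off the factor `ν`
    rw [← mul_prod_erase univ _ (mem_univ ν), ← mul_prod_erase univ _ (mem_univ ν)]
    have hrest : ∏ μ ∈ univ.erase ν, ((((x.shift ν) μ).val % P.L ^ k : ℕ) : ℝ) * (((P.L ^ k : ℕ) : ℝ) - 1 - ((((x.shift ν) μ).val % P.L ^ k : ℕ) : ℝ))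
        = ∏ μ ∈ univ.erase ν, (((x μ).val % P.L ^ k : ℕ) : ℝ) * (((P.L ^ k : ℕ) : ℝ) - 1 - (((x μ).val % P.L ^ k : ℕ) : ℝ)) :=
      prod_congr rfl fun μ hμ => by rw [hothers μ (ne_of_mem_erase hμ)]
    rw [hrest, ← sub_mul, abs_mul, hoff]
    have h1 := abs_tau_succ_sub_le (ℓ := P.L ^ k) (m := (x ν).val % P.L ^ k) hcase
    have h2 : |∏ μ ∈ univ.erase ν, (((x μ).val % P.L ^ k : ℕ) : ℝ) * (((P.L ^ k : ℕ) : ℝ) - 1 - (((x μ).val % P.L ^ k : ℕ) : ℝ))|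
        ≤ ((((P.L ^ k : ℕ) : ℝ)) ^ 2 / 4) ^ (P.d - 1) := by
      rw [abs_of_nonneg (prod_nonneg fun μ _ => tau_nonneg (Nat.mod_lt _ hℓ))]
      calc ∏ μ ∈ univ.erase ν, (((x μ).val % P.L ^ k : ℕ) : ℝ) * (((P.L ^ k : ℕ) : ℝ) - 1 - (((x μ).val % P.L ^ k : ℕ) : ℝ))
          ≤ ∏ _μ ∈ univ.erase ν, (((P.L ^ k : ℕ) : ℝ)) ^ 2 / 4 := prod_le_prod (fun μ _ => tau_nonneg (Nat.mod_lt _ hℓ)) fun _ _ => tau_le _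
        _ = ((((P.L ^ k : ℕ) : ℝ)) ^ 2 / 4) ^ (P.d - 1) := by rw [prod_const, card_erase_of_mem (mem_univ ν), card_univ, Fintype.card_fin]
    push_cast at h1 h2 ⊢
    exact mul_le_mul h1 h2 (abs_nonneg _) (by positivity)
  · right
    have heq : (x ν).val % P.L ^ k + 1 = P.L ^ k := by omega
    have h0 := shift_offset_eq_zero_of_eq hk x ν heq
    have hlast : (x ν).val % P.L ^ k = P.L ^ k - 1 := by omega
    constructor
    · exact prod_eq_zero (mem_univ ν) (by rw [h0]; simp)
    · exact prod_eq_zero (mem_univ ν) (by rw [hlast]; exact tau_last hℓ)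

end Profile

end Summit.QuantumFields.YangMills.Theorems.Prop7CovariantBlockBumpsProfile

end
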